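import Literature.Probability.LatticeModels.PlanarIsingOnePointSpinorForm
import HarnessLib

/-!
# CHI Theorem 1.3 (`k = 0`), `ϱ`-normalised: decomposition into Theorems 1.5, 1.7 and Remark 2.18

Topic `Literature/Probability/LatticeModels`. SPLIT of the named fact
`Literature.Probability.LatticeModels.chi_onePoint_rho` (`PlanarIsingOnePoint.lean`;
Chelkak–Hongler–Izyurov, Ann. of Math. 181 (2015) = CHI15, Theorem 1.3 for `k = 0` with (1.2)–(1.3):
`ϱ(δ)^{-1/2} 𝔼⁺_{Ω_δ}[σ_a] → 2^{1/4} |φ'(a)|^{1/8} (2 Im φ a)^{-1/8}`) into the three printed inputs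
of CHI's §1.2 "Key steps in the proof" that the tree does not yet prove, following the PROVED chain
`Thm 1.5 & Rem 2.18 ⇒ Prop 2.20` (`LatticeRatioLimit.lean`, `PlanarIsingOnePointSpinorForm.lean`)
`& Thm 1.7 ⇒ Thm 1.1` (`PlanarIsingTwoPointProofs.lean`, §2.9) `⇒ Thm 1.3, k = 0`
(`PlanarIsingOnePointProofs.lean`, §2.10), assembled in `chi_onePoint_rho_of_spinorCoefficient`:

* `chi_plusTwoPoint_diagLogDerivative` — CHI15 Theorem 1.5 for `k = 1`, eq. (1.4) (discrete
  logarithmic derivatives of the `+` two-point function converge to `Re[𝒜_Ω s]`);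
* `chi_plusTwoPoint_nnRatio` — CHI15 Remark 2.18 for `k = 1` (ratios at adjacent faces tend to `1`);
* `chi_freePlusTwoPoint_ratio` — CHI15 Theorem 1.7 (the ratio of the free and `+` two-point
  functions tends to the conformal invariant `𝓑_Ω(a; b)`), in the moving-point form used in §2.9;

each quantified, like the parent, over bounded simply connected `Ω` whose discretisations
approximate it (`MeshApproximates Ω`) and conformal bijections `φ : Ω → ℍ` (through which
`𝒜_Ω = ACHI φ`, `𝓑_Ω = bCHI ∘ φ` are written, eq. (1.5) and (1.3)); and the PROVED assembly
`chi_onePoint_rho_holds_of`. All three children rest, in the source, on the convergence of the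
discrete spinor observables (§§2.4–2.6, §3), for which the tree has begun the continuum side
(`PlanarIsingHalfPlaneSpinor.lean`, `PlanarIsingLegendreSpinor.lean`, `PlanarIsingLogDerivative.lean`).

## References

* D. Chelkak, C. Hongler, K. Izyurov, *Conformal invariance of spin correlations in the planar
  Ising model*, Ann. of Math. (2) 181 (2015) 1087–1138; arXiv:1202.2838: Thm 1.5 with (1.4)–(1.5),
  Thm 1.7, Remark 2.18, Prop 2.20, Remark 2.21, §§2.8–2.10. [ChelkakHonglerIzyurovAnnals2015]
-/

noncomputable section

open Filter Topology Metric Set Real Complex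
open Literature.Probability.LatticeModels

namespace Literature.Probability.LatticeModels

/-! ## The children (named facts) -/

/-- NAMED FACT (CHI15 Theorem 1.5 for `k = 1`, eq. (1.4), in the tree's orientation). For every
bounded simply connected `Ω` whose discretisations approximate it, every conformal bijection
`φ : Ω → ℍ` and every `x ∈ Ω`: uniformly over lattice sites `v` with `δv` in a compact subset of
`Ω ∖ {x}`, for each of the four diagonal steps `s = ±1 ± i` of `δℤ²` (CHI's steps `a ↦ a + 2δ`,
`a ↦ a + 2iδ` of the `45°`-rotated face lattice),
`(𝔼⁺_{Ω_δ}[σ_x σ_{δ(v+s)}] / 𝔼⁺_{Ω_δ}[σ_x σ_{δv}] − 1)/δ − Re[𝒜_Ω(δv; x) · s] → 0` as `δ → 0⁺`,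
where `𝒜_Ω(w; x) = 𝒜_ℍ(φ w; φ x) φ'(w) + φ''(w)/(8φ'(w))` is CHI's coefficient ((1.5), `ACHI φ`).
Print: "`(2δ)⁻¹(𝔼⁺[σ_{a+2δ}σ_{a₁}⋯]/𝔼⁺[σ_aσ_{a₁}⋯] − 1) → Re 𝒜_Ω(a; a₁, …)`,
`(2δ)⁻¹(𝔼⁺[σ_{a+2iδ}⋯]/𝔼⁺[σ_a⋯] − 1) → −Im 𝒜_Ω`, uniformly over faces at distance `≥ ε` from
`∂Ω` and from each other" ("a cornerstone for the whole paper"; proved from the convergence of the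
discrete spinor observables near their singularity, §2.6 and §3). Hypothesis `hD` of
`chi_onePoint_rho_of_spinorCoefficient` verbatim. Users take
`(h : chi_plusTwoPoint_diagLogDerivative)`.
[cite: ChelkakHonglerIzyurovAnnals2015, Thm. 1.5, eq. (1.4)–(1.5)] -/
def chi_plusTwoPoint_diagLogDerivative : Prop :=
  ∀ (Ω : Set ℂ), IsAdmissibleDomain Ω → MeshApproximates Ω → ∀ (φ : ℂ → ℂ),
    IsConformalBijection φ Ω UpperHalfPlane.upperHalfPlaneSet → ∀ x ∈ Ω,
      ∀ K ⊆ Ω \ {x}, IsCompact K → ∀ s ∈ LatticeRatio.diagSteps, ∀ ε > (0 : ℝ), ∀ᶠ δ in 𝓝[>] (0 : ℝ),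
        ∀ v : Site 2, meshPoint δ v ∈ K →
          |(meshIsingPlusCorr Ω δ ![x, meshPoint δ (v + s)] / meshIsingPlusCorr Ω δ ![x, meshPoint δ v] - 1) / δ -
            (ACHI φ (meshPoint δ v) x * Site.toComplex s).re| < ε

/-- NAMED FACT (CHI15 Remark 2.18 for `k = 1`: nearest-neighbour ratios). For every bounded simply
connected `Ω` whose discretisations approximate it, every conformal bijection `φ : Ω → ℍ` and
every `x ∈ Ω`: uniformly over lattice sites `v` with `δv` in a compact subset of `Ω ∖ {x}`, for
each of the four unit steps `e` of `δℤ²` (CHI's adjacent faces `a + (1 ± i)δ`),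
`𝔼⁺_{Ω_δ}[σ_x σ_{δ(v+e)}] / 𝔼⁺_{Ω_δ}[σ_x σ_{δv}] → 1` as `δ → 0⁺`. Print: "this implies
`𝔼⁺[σ_{a+(1±i)δ}σ_{a₁}⋯]/𝔼⁺[σ_aσ_{a₁}⋯] → 1` uniformly over all `a, a₁, …` at distance at least
`ε` from `∂Ω` and from each other". Hypothesis `hN` of `chi_onePoint_rho_of_spinorCoefficient`
verbatim (the conformal map is carried only for uniformity with the other children). Users take
`(h : chi_plusTwoPoint_nnRatio)`. [cite: ChelkakHonglerIzyurovAnnals2015, Remark 2.18] -/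
def chi_plusTwoPoint_nnRatio : Prop :=
  ∀ (Ω : Set ℂ), IsAdmissibleDomain Ω → MeshApproximates Ω → ∀ (φ : ℂ → ℂ),
    IsConformalBijection φ Ω UpperHalfPlane.upperHalfPlaneSet → ∀ x ∈ Ω,
      ∀ K ⊆ Ω \ {x}, IsCompact K → ∀ s ∈ LatticeRatio.nnSteps, ∀ ε > (0 : ℝ), ∀ᶠ δ in 𝓝[>] (0 : ℝ),
        ∀ v : Site 2, meshPoint δ v ∈ K →
          |meshIsingPlusCorr Ω δ ![x, meshPoint δ (v + s)] / meshIsingPlusCorr Ω δ ![x, meshPoint δ v] - 1| < ε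

/-- NAMED FACT (CHI15 Theorem 1.7, free/`+` ratio of two-point functions, moving-point form).
For every bounded simply connected `Ω` whose discretisations approximate it, every conformal
bijection `φ : Ω → ℍ`, every `x ∈ Ω` and marked points `y_δ → y₀ ∈ Ω ∖ {x}`:
`𝔼^free_{Ω_δ}[σ_x σ_{y_δ}] / 𝔼⁺_{Ω_δ}[σ_x σ_{y_δ}] → 𝓑_Ω(x; y₀) = 𝓑_ℍ(φ x; φ y₀)` as `δ → 0⁺`,
where `𝓑_Ω(a;b) = ⟨σ_aσ_b⟩^free_Ω/⟨σ_aσ_b⟩⁺_Ω` is CHI's conformal invariant (`bCHI`, from (1.3))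
and `𝔼^free_{Ω_δ}` is the critical model with free boundary conditions on the faces of the same
discrete domain (`meshIsingFreeCorr`; CHI p. 19: "the fact that we have `Ω_δ^• − δ` instead of
`Ω_δ` plays no role"). Print (Thm 1.7): "`𝔼^free_{Ω_δ^•}[σ_{a+δ}σ_{b+δ}] / 𝔼⁺_{Ω_δ}[σ_aσ_b] →
𝓑_Ω(a;b)` uniformly over all faces `a, b` at distance at least `ε` from `∂Ω` and from each other"
(proved from the convergence of the discrete spinor observables and Kramers–Wannier duality,
§§2.4–2.5, §3); the moving-point form follows from the uniformity and the continuity of `𝓑_Ω`.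
Hypothesis `hB` of `chi_onePoint_rho_of_spinorCoefficient` verbatim. Users take
`(h : chi_freePlusTwoPoint_ratio)`. [cite: ChelkakHonglerIzyurovAnnals2015, Thm. 1.7 with eq. (1.3); §2.9 (proof of Thm. 1.1)] -/
def chi_freePlusTwoPoint_ratio : Prop :=
  ∀ (Ω : Set ℂ), IsAdmissibleDomain Ω → MeshApproximates Ω → ∀ (φ : ℂ → ℂ),
    IsConformalBijection φ Ω UpperHalfPlane.upperHalfPlaneSet →
      ∀ x ∈ Ω, ∀ (y : ℝ → ℂ) (y₀ : ℂ), y₀ ∈ Ω → y₀ ≠ x → Tendsto y (𝓝[>] 0) (𝓝 y₀) →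
        Tendsto (fun δ => meshIsingFreeCorr Ω δ ![x, y δ] / meshIsingPlusCorr Ω δ ![x, y δ])
          (𝓝[>] 0) (𝓝 (bCHI (φ x) (φ y₀)))

/-! ## The assembly (proved) -/

/-- **CHI Theorem 1.3 (`k = 0`) from Theorems 1.5, 1.7 and Remark 2.18 (SPLIT assembly).**
`chi_plusTwoPoint_diagLogDerivative → chi_plusTwoPoint_nnRatio → chi_freePlusTwoPoint_ratio →
chi_onePoint_rho`, by `chi_onePoint_rho_of_spinorCoefficient` (§§2.8–2.10 of the source are
theorems of the tree). [cite: ChelkakHonglerIzyurovAnnals2015, Thm. 1.3 (k = 0) via Thm. 1.5, Remark 2.18, Thm. 1.7, §§2.8–2.10] -/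
theorem chi_onePoint_rho_holds_of (h₁ : chi_plusTwoPoint_diagLogDerivative)
    (h₂ : chi_plusTwoPoint_nnRatio) (h₃ : chi_freePlusTwoPoint_ratio) : chi_onePoint_rho :=
  chi_onePoint_rho_of_spinorCoefficient h₁ h₂ h₃

end Literature.Probability.LatticeModels
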